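import Literature.MathematicalPhysics.QuantumFieldTheory.Balaban1983to89.Node00.CarriersY
import Literature.MathematicalPhysics.QuantumFieldTheory.Balaban1983to89.B9Eq39Adjoint

/-!
# NODE 00 — the [B9] operator layer of Stage 3′(Y) AS A FUNCTION OF BAŁABAN'S COVARIANT LETTERS (`OpsY` instance, v1)

Stage 3′(Y)'s [B9] carrier bundle `Node00.Y9OfRecord N θ M⋆ ops` takes the OPERATOR LAYER `ops : Node00.OpsY N θ M⋆` — one
`B9PinCarriersKLevelV1.OperatorLayerY` (24 fields) per member `x : MemberY` — as a bare parameter; every N06 leaf of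
`Summits/…/BalabanUVNodesN06AtRecord11CB10YZW` is stated at a section variable `ops`.  This module DEFINES that layer from
Bałaban's covariant lattice LETTERS, in three honest parts:

1. **GENUINE COVARIANT LATTICE CALCULUS at a member** ([B9] (3.3), (3.8), (3.23), pp. 390–395) on `𝔸`-valued lattice functions:
   the background `U : CfgV1 (PV d ℓ x.m x.K hd hL) 𝔸` (Setup torus) acts by `R(U)X = UXU⁻¹` (`B9Eq39Adjoint.R`); the covariant
   derivatives `∇_{U,μ}`, `∇*_{U,μ}`, the covariant Laplacian `Σ_μ ∇*_{U,μ}∇_{U,μ}` are `B9Eq39Adjoint.covD ∕ covDstar` at the shifts of the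
   torus — on the SITE sector (functions on NODE 00's box chart `↥(toKT i).XB`, background transported by `B6GlobalChartV1.boxEquiv`;
   shift compatibility is `B6ScalarChartV1.toBox_shift`) and on the BOND sector (functions on `PBond (PV …) 0`, componentwise, in the
   physical units `c_f` of r03's `DV ∕ DVa ∕ LapV`); the parallel transporter of (3.40) is a letter (below).
2. **THE READING** (print's functionals (3.39)–(3.41), (3.42)–(3.47), (3.48), (3.49), (3.133) of an `𝔸`-valued operator): NODE 00's
   arguments `λ` are SCALAR lattice functions (`Node00.KLoc i`, the [B6] census carriers kept verbatim so that Cor. 3.5 «for U = 1 these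
   theorems are proved in [4]» is a comparison of like with like); a scalar `λ` is read in PRODUCT FORM `λ ⊗ E = fun z ↦ (λ z : ℂ) • E` along a
   direction `E` of the closed unit ball of `𝔸`, and every functional is the supremum over that ball of NODE 00's formula with `|·|` replaced
   by `‖·‖` and the flat differences by the covariant ones (by linearity, print's bounds for all `𝔸`-valued `λ` and for all product-form `λ`
   agree up to a dimension constant).  G′-type letters are read ON the site summand `.inl` and are `0` OFF it, G-type letters ON the bond
   summand `.inr` and `0` OFF it — the ON∕OFF shape of `Node00.GpU ∕ GU` (dag-n06-h's `B9Cor35ComparisonsEH`).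
3. **THE LETTER INTERFACE** `CovLettersY x` — Bałaban's lattice operators AS FUNCTIONS OF `U` (G′(U) (3.25), G(U) (3.27), the transporters
   U(Γ_{x,x′}) of (3.40), (Q′G′²Q′*)⁻¹ (3.48), the Sect. D∕E letters 𝔾_D, G₁, 𝔾, G(Ω) − G(Ω′), H, H₁, C^{(k)}, (QGQ*)⁻¹, (QG₁Q*)⁻¹, P = I − R),
   typed as ℂ-linear maps between `𝔸`-valued function spaces, TOGETHER WITH the printed `U = 1` clauses as `Prop` fields (p. 395 «It coincides
   with Δ_a in (2.19) if U = 1»; Cor. 3.5 p. 407): at `U = 1` the letters are the lifts of NODE 00's genuine [B6] operators of record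
   (`KTIdx.G = gmlT …`, r03's `Gop`, T8's `CinvTP`).  `ExpLettersY x` carries the ten predicate ∕ expansion-valued fields (analyticity (3.37),
   the random-walk expansions of Thms 3.7–3.10, positivity, (3.185)) that the n06-c ∕ n06-d pins (`B9Thm37Whole.E37OfOps`, …) instantiate.
   **The instance**: `operatorLayerYOfLetters x 𝔏 𝔈 : OperatorLayerY … x` and, at the record's carriers (`𝔸 = Matrix (Fin N) (Fin N) ℂ`,
   `G = SU(N)`), `opsYOfLetters N θ M⋆ 𝔏 𝔈 : OpsY N θ M⋆`.

HONEST SCOPE.  (a) The CONSTRUCTION of the letters from Bałaban's `Δ′_a(U) = Δ_U + Σ_j a_j(Lʲη)⁻² Q′_j(U)*1_{Λ_j}Q′_j(U)` with the composite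
covariant averages `Q′_j(U)` over the member's genuine domain sequence `x.D` ([5] (52)–(53), [B9] (3.14)–(3.25)) is NOT in this module: it is
the successor item `lettersYOfRecord` (the tree's `B9Eq324DeltaPrimeATower.GpOfUk` ∕ `B9Eq326OperatorTower` are the all-small-field case on
`TSite` carriers), after which `opsYOfRecord N θ M⋆ := opsYOfLetters N θ M⋆ lettersYOfRecord …` closes the layer; until then the N06 leaves are
pinned at `opsYOfLetters N θ M⋆ 𝔏 𝔈` with `𝔏 𝔈` section variables of a NAMED interface carrying the printed `U = 1` clauses.  (b) The interface
is inhabited by FLAT letters (`covLettersY_flat`, §7) — recorded so that no statement over `∀ 𝔏` is vacuous, and flagged: flat letters are not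
Bałaban's.  (c) Nothing of print is asserted: DEFINITIONS + `rfl` ∕ one-line lemmas; no estimate; one finite lattice programme; NOT continuum ∕
OS ∕ mass gap ∕ Clay.  (d) The `U = 1` comparison rows of the N06 knit (Cor. 3.5 p. 407; binders `hGp_e … hGA_l2`, `hC`, `hE4`, `hH2` of
`b9LeafX_carriersY`) are NOT proved here: dag-n06-f's `B9Cor35ComparisonsGpC`, dag-n06-g's `B9Cor35ComparisonsGA` (whose `GAOfOps`
polarises along a direction set WITHOUT the transporter of (3.40) — the two readings agree at `U = 1`, where rows are decided) and dag-n06-h's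
`B9Cor35ComparisonsEH` type them against §6 (`rfl` unfoldings, the OFF-summand nulls, the two `iSup` helpers, and ONE worked ON-entry
`Gp_e0_one_le` showing the pattern: flatness field ⇒ `liftY` ⇒ `norm_liftY_le` ⇒ `iSup_ite_le_iSup_ite`).  Unit `pub-ymgap-node00-def-Y` (g0),
2026-08-26.
-/

noncomputable section

namespace Literature.MathematicalPhysics.QuantumFieldTheory.Balaban1983to89.Node00

open LatticeFieldCalculus (supDist)
open B9Eq39Adjoint (R)
open B4TorusKernel.MultiPeriod (torusSupNorm)
open B6SectAOperatorsV1 (BondIdx)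
open B6MultiLevelTorusOperator (tshift unitVec)
open B6GlobalChartV1 (PV domT blkV1 boxEquiv)
open B6Geom246MultiLevelBox (bset blkOf)
open B6Ineq2142KLevelV1 (lvl β)
open B6KLevelCensusIndexV1 (KIdx Adm)
open B6Prop22KLevelTorusCensus (KTIdx)
open B6Prop22KLevelTorusCensusEta (nKT hqTP)
open B6Prop22KLevelCensusEta (epow)
open B6Cor28PrintedKLevelV1 (vol)
open B8ScaledSupNorm (msup)
open B9BackgroundsKLevelV1 (CfgV1 shiftsV1)
open B9PinMembersKLevelV1 (MemberY geo9Y bg9Y)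
open B9PinCarriersKLevelV1 (OperatorLayerY carriersY)
open B7Prop2SpecialUnitary (specialUnitaryUnits)
open scoped Matrix

variable {d ℓ : ℕ} {hd : 1 ≤ d + 1} {hL : Odd (ℓ + 1) ∧ 1 < ℓ + 1} {b₀ b₁ : ℝ} {Mstar : ℕ}
variable {𝔸 : Type} [NormedRing 𝔸] [NormedAlgebra ℂ 𝔸] [CompleteSpace 𝔸]

/-! ## §1 Carriers at a k-level index and the product-form lift -/

/-- the fine SITES at an index: NODE 00's box chart of the torus `T_η` (`↥(toKT i).XB`). [cite: Balaban1985BackgroundPropagators, p.389 (T_η), dictionary] -/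
abbrev SiteY (i : KIdx d ℓ hd hL b₀ b₁) : Type := ↥(toKT i).XB
/-- the fine positively oriented BONDS at an index (Setup torus). [cite: Balaban1985BackgroundPropagators, (3.1) p.390, dictionary] -/
abbrev FBondY (i : KIdx d ℓ hd hL b₀ b₁) : Type := PBond (PV d ℓ i.m i.K hd hL) 0
/-- the coarse sites `𝔅 = ⋃_j Λ_j` (blocks of the multi-level domain sequence). [cite: Balaban1985BackgroundPropagators, p.397 (𝔅), dictionary] -/
abbrev BlkY (i : KIdx d ℓ hd hL b₀ b₁) : Type := ↥(bset i.D.toDomains)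
/-- the coarse bonds (= the index bonds of NODE 00's `kGeoU i`, i.e. `(geo9K i).Site`). [cite: Balaban1985BackgroundPropagators, p.397, dictionary] -/
abbrev IBondY (i : KIdx d ℓ hd hL b₀ b₁) : Type := BondIdx (domT i.hN i.D i.hk)
/-- the background configurations at an index (`= (bg9K 𝔸 G i).Cfg`). [cite: Balaban1985BackgroundPropagators, (3.35) p.396, dictionary] -/
abbrev CfgY (𝔸 : Type) [NormedRing 𝔸] [NormedAlgebra ℂ 𝔸] [CompleteSpace 𝔸] (i : KIdx d ℓ hd hL b₀ b₁) : Type :=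
  CfgV1 (PV d ℓ i.m i.K hd hL) 𝔸

/-- the closed unit ball of `𝔸` (the directions `E` of the product-form reading). [cite: Balaban1985BackgroundPropagators, (3.39) p.397, dictionary] -/
abbrev BallY (𝔸 : Type) [NormedRing 𝔸] [NormedAlgebra ℂ 𝔸] [CompleteSpace 𝔸] : Type := ↥(Metric.closedBall (0 : 𝔸) 1)

/-- the ball is inhabited (by `0`). [cite: Balaban1985BackgroundPropagators, (3.39) p.397, bookkeeping] -/
theorem ballY_nonempty : Nonempty (BallY 𝔸) := ⟨⟨0, Metric.mem_closedBall_self zero_le_one⟩⟩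

/-- **the product-form lift** `λ ⊗ E`: a scalar lattice function `λ` along the direction `E ∈ 𝔸`. [cite: Balaban1985BackgroundPropagators, (3.39) p.397 (𝔤-valued λ), dictionary] -/
def liftY {X : Type} (f : X → ℝ) (E : 𝔸) : X → 𝔸 := fun z => ((f z : ℝ) : ℂ) • E

omit [CompleteSpace 𝔸] in
/-- the lift, evaluated. [cite: Balaban1985BackgroundPropagators, (3.39) p.397, dictionary] -/
@[simp] theorem liftY_apply {X : Type} (f : X → ℝ) (E : 𝔸) (z : X) : liftY f E z = ((f z : ℝ) : ℂ) • E := rfl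

/-- `‖(λ ⊗ E)(z)‖ ≤ |λ z|` for `‖E‖ ≤ 1` — the pointwise domination behind every `U = 1` comparison of the reading.
[cite: Balaban1985BackgroundPropagators, Cor. 3.5 p.407 (U = 1 reduces to [4]), bookkeeping] -/
theorem norm_liftY_le {X : Type} (f : X → ℝ) (E : BallY 𝔸) (z : X) : ‖liftY f (E : 𝔸) z‖ ≤ |f z| := by
  have hE : ‖(E : 𝔸)‖ ≤ 1 := mem_closedBall_zero_iff.1 E.2
  calc ‖liftY f (E : 𝔸) z‖ = ‖((f z : ℝ) : ℂ)‖ * ‖(E : 𝔸)‖ := norm_smul _ _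
    _ ≤ |f z| * 1 := by
        rw [Complex.norm_real, Real.norm_eq_abs]
        exact mul_le_mul_of_nonneg_left hE (abs_nonneg _)
    _ = |f z| := mul_one _

open Classical in
/-- the `𝔸`-valued delta function `δ_w ⊗ E` (kernel entries of a letter are its values on these). [cite: Balaban1985BackgroundPropagators, (3.48) p.398 (kernels), dictionary] -/
def deltaY {X : Type} (w : X) (E : 𝔸) : X → 𝔸 := fun z => if z = w then E else 0

/-! ## §2 Genuine covariant lattice calculus at an index ([B9] (3.3), (3.8), (3.23)) -/

section Calculus

variable (i : KIdx d ℓ hd hL b₀ b₁)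

/-- the background transported to the box chart: `U_μ(z) = U(x, x + e_μ)` at the torus site `x` charted to `z`. [cite: Balaban1985BackgroundPropagators, (3.1) p.390, dictionary (chart `B6GlobalChartV1.boxEquiv`)] -/
def UboxY (U : CfgY 𝔸 i) : Fin (d + 1) → SiteY i → 𝔸ˣ := fun μ z => U μ ((boxEquiv i.hN).symm z)

/-- the shifts `z ↦ z + e_μ` of the box chart (NODE 00's `tshift NB (unitVec μ)`; `= boxEquiv ∘ shift ∘ boxEquiv⁻¹` by `B6ScalarChartV1.toBox_shift`).
[cite: Balaban1985BackgroundPropagators, (3.3) p.390, dictionary] -/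
def shiftY : Fin (d + 1) → Equiv.Perm (SiteY i) := fun μ => tshift (toKT i).NB (unitVec μ)

/-- **(3.3) on the site sector, lattice units**: `(∇_{U,μ}Φ)(z) = R(U_μ(z))Φ(z + e_μ) − Φ(z)`. [cite: Balaban1985BackgroundPropagators, (3.3) p.390] -/
def cdS (U : CfgY 𝔸 i) (μ : Fin (d + 1)) (Φ : SiteY i → 𝔸) : SiteY i → 𝔸 := B9Eq39Adjoint.covD (shiftY i) (UboxY i U) μ Φ

/-- **(3.8)'s `∇*_{U,μ}` on the site sector, lattice units**: `R(U(z, z − e_μ))Φ(z − e_μ) − Φ(z)`. [cite: Balaban1985BackgroundPropagators, (3.8) p.392] -/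
def cdsS (U : CfgY 𝔸 i) (μ : Fin (d + 1)) (Φ : SiteY i → 𝔸) : SiteY i → 𝔸 := B9Eq39Adjoint.covDstar (shiftY i) (UboxY i U) μ Φ

/-- **the covariant Laplacian on the site sector, lattice units**: `Σ_μ ∇*_{U,μ}∇_{U,μ}` (at `U = 1` the periodic `−Δ` of NODE 00's `perLapT`, up to sign).
[cite: Balaban1985BackgroundPropagators, (3.23) p.395] -/
def lapS (U : CfgY 𝔸 i) (Φ : SiteY i → 𝔸) : SiteY i → 𝔸 := fun z => ∑ μ : Fin (d + 1), cdsS i U μ (cdS i U μ Φ) z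

/-- **(3.3) on the bond sector, physical units `c_f`** (componentwise on `A_ν`, as r03's `DV μ c_f = c_f • (shB μ − 1)` at `U = 1`):
`(∇_{U,μ}A)_ν(x) = c_f·(R(U_μ(x))A_ν(x + e_μ) − A_ν(x))`. [cite: Balaban1985BackgroundPropagators, (3.3), (3.39) pp.390, 397] -/
def cdB (U : CfgY 𝔸 i) (μ : Fin (d + 1)) (A : FBondY i → 𝔸) : FBondY i → 𝔸 :=
  fun b => ((i.cf : ℝ) : ℂ) • B9Eq39Adjoint.covD (shiftsV1 (PV d ℓ i.m i.K hd hL)) U μ (fun s => A ⟨s, b.dir⟩) b.src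

/-- **`∇*_{U,μ}` on the bond sector, physical units** (r03's `DVa μ c_f` at `U = 1`). [cite: Balaban1985BackgroundPropagators, (3.8) p.392] -/
def cdsB (U : CfgY 𝔸 i) (μ : Fin (d + 1)) (A : FBondY i → 𝔸) : FBondY i → 𝔸 :=
  fun b => ((i.cf : ℝ) : ℂ) • B9Eq39Adjoint.covDstar (shiftsV1 (PV d ℓ i.m i.K hd hL)) U μ (fun s => A ⟨s, b.dir⟩) b.src

/-- **the covariant Laplacian on the bond sector** `Σ_μ ∇*_{U,μ}∇_{U,μ}` (r03's `LapV c_f = Σ DVa·DV` at `U = 1`). [cite: Balaban1985BackgroundPropagators, (3.23) p.395] -/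
def lapB (U : CfgY 𝔸 i) (A : FBondY i → 𝔸) : FBondY i → 𝔸 := fun b => ∑ μ : Fin (d + 1), cdsB i U μ (cdB i U μ A) b

/-- at `U = 1` the covariant derivative is the flat forward difference. [cite: Balaban1985BackgroundPropagators, p.395 («coincides with Δ_a … if U = 1»)] -/
theorem cdS_one (μ : Fin (d + 1)) (Φ : SiteY i → 𝔸) (z : SiteY i) :
    cdS i (fun _ _ => 1) μ Φ z = Φ (shiftY i μ z) - Φ z := by
  simp [cdS, B9Eq39Adjoint.covD, UboxY]

/-- at `U = 1`, `∇*` is the flat backward difference. [cite: Balaban1985BackgroundPropagators, p.395] -/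
theorem cdsS_one (μ : Fin (d + 1)) (Φ : SiteY i → 𝔸) (z : SiteY i) :
    cdsS i (fun _ _ => 1) μ Φ z = Φ ((shiftY i μ).symm z) - Φ z := by
  simp [cdsS, B9Eq39Adjoint.covDstar, UboxY]

/-- at `U = 1` the bond-sector covariant derivative is r03's `c_f·(A(x + e_μ) − A(x))`. [cite: Balaban1985BackgroundPropagators, p.395] -/
theorem cdB_one (μ : Fin (d + 1)) (A : FBondY i → 𝔸) (b : FBondY i) :
    cdB i (fun _ _ => 1) μ A b = ((i.cf : ℝ) : ℂ) • (A ⟨shiftsV1 (PV d ℓ i.m i.K hd hL) μ b.src, b.dir⟩ - A b) := by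
  simp [cdB, B9Eq39Adjoint.covD]

/-- at `U = 1` the bond-sector `∇*` is r03's `c_f·(A(x − e_μ) − A(x))`. [cite: Balaban1985BackgroundPropagators, p.395] -/
theorem cdsB_one (μ : Fin (d + 1)) (A : FBondY i → 𝔸) (b : FBondY i) :
    cdsB i (fun _ _ => 1) μ A b = ((i.cf : ℝ) : ℂ) • (A ⟨(shiftsV1 (PV d ℓ i.m i.K hd hL) μ).symm b.src, b.dir⟩ - A b) := by
  simp [cdsB, B9Eq39Adjoint.covDstar]

end Calculus

/-! ## §3 The reading: print's functionals of an `𝔸`-valued letter, in NODE 00's shapes -/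

section Reading

variable (i : KIdx d ℓ hd hL b₀ b₁)

/-- a SITE-SECTOR letter: an operator on `𝔸`-valued site functions, depending on `U` (G′(U) and its relatives). [cite: Balaban1985BackgroundPropagators, (3.25) p.395] -/
abbrev SiteOpY (𝔸 : Type) [NormedRing 𝔸] [NormedAlgebra ℂ 𝔸] [CompleteSpace 𝔸] (i : KIdx d ℓ hd hL b₀ b₁) : Type :=
  CfgY 𝔸 i → (SiteY i → 𝔸) →ₗ[ℂ] (SiteY i → 𝔸)
/-- a BOND-SECTOR letter: an operator on `𝔸`-valued fine-bond functions, depending on `U` (G(U), 𝔾_D, G₁, 𝔾, G(Ω) − G(Ω′), P = I − R).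
[cite: Balaban1985BackgroundPropagators, (3.27) p.395] -/
abbrev BondOpY (𝔸 : Type) [NormedRing 𝔸] [NormedAlgebra ℂ 𝔸] [CompleteSpace 𝔸] (i : KIdx d ℓ hd hL b₀ b₁) : Type :=
  CfgY 𝔸 i → (FBondY i → 𝔸) →ₗ[ℂ] (FBondY i → 𝔸)
/-- a site transporter `U(Γ_{z,z′})` for the Hölder norms (3.40) of the site sector. [cite: Balaban1985BackgroundPropagators, (3.40) p.397] -/
abbrev SiteParY (𝔸 : Type) [NormedRing 𝔸] [NormedAlgebra ℂ 𝔸] [CompleteSpace 𝔸] (i : KIdx d ℓ hd hL b₀ b₁) : Type :=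
  CfgY 𝔸 i → SiteY i → SiteY i → 𝔸ˣ
/-- a transporter `U(Γ_{x,x′})` between torus sites for the Hölder norms (3.40) of the bond sector. [cite: Balaban1985BackgroundPropagators, (3.40) p.397] -/
abbrev BondParY (𝔸 : Type) [NormedRing 𝔸] [NormedAlgebra ℂ 𝔸] [CompleteSpace 𝔸] (i : KIdx d ℓ hd hL b₀ b₁) : Type :=
  CfgY 𝔸 i → Site (PV d ℓ i.m i.K hd hL) 0 → Site (PV d ℓ i.m i.K hd hL) 0 → 𝔸ˣ

/-- `η = L^{−k}` of the site sector (T8's `nKT`). [cite: Balaban1985BackgroundPropagators, p.389, dictionary] -/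
def etaS : ℝ := ((((nKT (toKT i) : ℕ) : ℝ)))⁻¹

open Classical in
/-- `sup_{z ∈ Δ(s)} ‖Ψ(z)‖` on the site sector (NODE 00's `KTIdx.e0` shape). [cite: Balaban1985BackgroundPropagators, (3.42) p.397 («for x ∈ Δ(y)»)] -/
def supBlkS (s : BlkY i) (Ψ : SiteY i → 𝔸) : ℝ := ⨆ z : SiteY i, if blkOf i.D.toDomains z = s then ‖Ψ z‖ else 0

open Classical in
/-- `sup_{z ∈ Δ(s), μ} ‖Ψ_μ(z)‖` on the site sector (NODE 00's `KTIdx.e1 ∕ e2` shape). [cite: Balaban1985BackgroundPropagators, (3.42) p.397] -/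
def supBlkS' (s : BlkY i) (Ψ : Fin (d + 1) → SiteY i → 𝔸) : ℝ :=
  ⨆ p : SiteY i × Fin (d + 1), if blkOf i.D.toDomains p.1 = s then ‖Ψ p.2 p.1‖ else 0

open Classical in
/-- **the covariant Hölder quotient (3.40) on the site sector, print's units**: `sup_{z ≠ z′} ‖R(U(Γ_{z,z′}))Ψ(z′) − Ψ(z)‖ ∕ (η|z′ − z|_T)^α`
(T8's `hqTP` with the transporter). [cite: Balaban1985BackgroundPropagators, (3.40) p.397] -/
def hqS (par : SiteY i → SiteY i → 𝔸ˣ) (α : ℝ) (Ψ : SiteY i → 𝔸) : ℝ :=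
  ⨆ p : SiteY i × SiteY i, if p.1 ≠ p.2 then
    ‖R (par p.1 p.2) (Ψ p.2) - Ψ p.1‖ / (torusSupNorm (toKT i).NB (p.2.1 - p.1.1) / (nKT (toKT i))) ^ α else 0

/-- the sup over fine bonds of the block `y` of `‖Ψ‖` (r03's `supIn`). [cite: Balaban1985BackgroundPropagators, (3.42) p.397 («for x ∈ Δ(y)»)] -/
def supInB (y : BlkY i) (Ψ : FBondY i → 𝔸) : ℝ := ⨆ x : {x : FBondY i // blkV1 i.hN i.D x = y}, ‖Ψ x.1‖

open Classical in
/-- **the covariant Hölder quotient (3.40) of `ζΨ` on the bond sector** over r03's admissible pairs (`holderQ` with the transporter):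
`sup (|x − x′|c_f⁻¹)^{−α} ‖ζ(x)Ψ(x) − R(U(Γ_{x,x′}))ζ(x′)Ψ(x′)‖`. [cite: Balaban1985BackgroundPropagators, (3.40) p.397] -/
def holderQB (par : Site (PV d ℓ i.m i.K hd hL) 0 → Site (PV d ℓ i.m i.K hd hL) 0 → 𝔸ˣ) (α : ℝ) (ζ : FBondY i → ℝ) (Ψ : FBondY i → 𝔸) : ℝ :=
  ⨆ q : FBondY i × FBondY i, if Adm i q.1 q.2 then
    ((((supDist q.1.src q.2.src : ℕ) : ℝ)) * |i.cf|⁻¹) ^ (-α) * ‖((ζ q.1 : ℝ) : ℂ) • Ψ q.1 - R (par q.1.src q.2.src) (((ζ q.2 : ℝ) : ℂ) • Ψ q.2)‖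
  else 0

/-- the flat `L²` norm of `h·Ψ`: `(Σ_x (h(x)‖Ψ(x)‖)²)^{1/2}` (r03's `l2Of`). [cite: Balaban1985BackgroundPropagators, (3.46) p.398] -/
def l2OfY {X : Type} [Fintype X] (h : X → ℝ) (Ψ : X → 𝔸) : ℝ := Real.sqrt (∑ x, (h x * ‖Ψ x‖) ^ 2)

/-- **(3.41) `|Ψ|_{(α)}` of an `𝔸`-valued site function** (the membership «block of level j» of `B9GeoNormsKLevelV1.wNormS`). [cite: Balaban1985BackgroundPropagators, (3.41) p.397] -/
def wNormSY (α : ℝ) (Ψ : SiteY i → 𝔸) : ℝ := msup (ℓ + 1) i.k |i.cf|⁻¹ α (fun j (z : SiteY i) => (blkOf i.D.toDomains z).1.1 = j) Ψ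

/-- **(3.41) `|Ψ|_{(α)}` of an `𝔸`-valued bond function** (membership as `B9GeoNormsKLevelV1.wNormB`). [cite: Balaban1985BackgroundPropagators, (3.41) p.397] -/
def wNormBY (α : ℝ) (Ψ : FBondY i → 𝔸) : ℝ := msup (ℓ + 1) i.k |i.cf|⁻¹ α (fun j (x : FBondY i) => (blkV1 i.hN i.D x).1.1 = j) Ψ

/-! ### §3.1 The `B9.KernelFamily` of a site-sector letter (G′(U)): ON `.inl`, `0` OFF -/

/-- the four sup entries (3.42) of a site-sector letter at `(U, λ ⊗ E, s)`, LATTICE units: `‖(OΛ)(z)‖, ‖(∇_{U,μ}OΛ)(z)‖, ‖(O∇*_{U,μ}Λ)(z)‖, ‖(Δ_U OΛ)(z)‖`.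
[cite: Balaban1985BackgroundPropagators, (3.42) p.397] -/
def eLatS (O : SiteOpY 𝔸 i) (U : CfgY 𝔸 i) (Λ : SiteY i → 𝔸) (s : BlkY i) : Fin 4 → ℝ :=
  ![supBlkS i s (O U Λ),
    supBlkS' i s (fun μ => cdS i U μ (O U Λ)),
    supBlkS' i s (fun μ => O U (cdsS i U μ Λ)),
    supBlkS i s (lapS i U (O U Λ))]

open Classical in
/-- the two Hölder members (3.43) of a site-sector letter at `(U, Λ, α, ζ)`, print's units (T8's `hHTP` shape): `‖ζ∇^η_{U,μ}OΛ‖_α`, `‖ζO∇^{η*}_{U,μ}Λ‖_α`.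
[cite: Balaban1985BackgroundPropagators, (3.43) p.398] -/
def hLatS (O : SiteOpY 𝔸 i) (par : SiteParY 𝔸 i) (U : CfgY 𝔸 i) (Λ : SiteY i → 𝔸) (α : ℝ) (ζ : SiteY i → ℝ) : ℝ :=
  ⨆ p : Fin (d + 1) × Bool, if p.2 then
      hqS i (par U) α (fun z => ((ζ z * etaS i : ℝ) : ℂ) • cdS i U p.1 (O U Λ) z)
    else hqS i (par U) α (fun z => ((ζ z * etaS i : ℝ) : ℂ) • O U (cdsS i U p.1 Λ) z)

open Classical in
/-- **THE `B9.KernelFamily` READING OF A SITE-SECTOR LETTER** on NODE 00's geometry `geo9K i` and ANY backgrounds record over `CfgY`: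
`e n` = `η^{(2,1,1,0)}·sup_E (eLatS n)` ON `.inl f` (`Λ = f ⊗ E`), `0` OFF; `h1` = `sup_E hLatS` ON (`.inl f`, `.inl ζ`), `0` OFF; `e4` (3.44) =
`sup_E sup_{z ∈ Δ, μ, ν} η⁰‖(∇_μ O ∇*_ν Λ)(z)‖`… in lattice units with prefactor `η^0`; `h2` (3.45) its Hölder quotient; `l2 n` (3.46) the six flat
`L²` quantities with cut-off `h` (`.inl`), prefactors `η^{(2,1,1,0,0,0)}`; `glob n γ` (3.47) = `sup_E |η^{epow n}·entry_n|_{(epow n + γ)}`.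
[cite: Balaban1985BackgroundPropagators, Thm 3.1 (3.42)–(3.47) pp.397–398] -/
def kernelFamilyS (B : B9.Backgrounds) (cfg : B.Cfg → CfgY 𝔸 i) (O : SiteOpY 𝔸 i) (par : SiteParY 𝔸 i) :
    B9.KernelFamily (B9GeoNormsKLevelV1.geo9K i) B where
  e := fun n U' lam b => let U := cfg U'; match lam with
    | .inl f => etaS i ^ (epow n) * ⨆ E : BallY 𝔸, eLatS i O U (liftY f (E : 𝔸)) (β i.hN i.D i.hk b) n
    | .inr _ => 0
  h1 := fun U' lam α ζ => let U := cfg U'; match lam, ζ with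
    | .inl f, .inl z => ⨆ E : BallY 𝔸, hLatS i O par U (liftY f (E : 𝔸)) α z
    | _, _ => 0
  e4 := fun U' lam b => let U := cfg U'; match lam with
    | .inl f => ⨆ E : BallY 𝔸, ⨆ μ : Fin (d + 1),
        supBlkS' i (β i.hN i.D i.hk b) (fun ν => cdS i U μ (O U (cdsS i U ν (liftY f (E : 𝔸)))))
    | .inr _ => 0
  h2 := fun U' lam α ζ => let U := cfg U'; match lam, ζ with
    | .inl f, .inl z => ⨆ E : BallY 𝔸, ⨆ μ : Fin (d + 1), ⨆ ν : Fin (d + 1),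
        hqS i (par U) α (fun w => ((z w : ℝ) : ℂ) • cdS i U μ (O U (cdsS i U ν (liftY f (E : 𝔸)))) w)
    | _, _ => 0
  l2 := fun n U' lam h => let U := cfg U'; match lam, h with
    | .inl f, .inl hh => etaS i ^ ((![2, 1, 1, 0, 0, 0] : Fin 6 → ℕ) n) * ⨆ E : BallY 𝔸,
        ((![l2OfY hh (O U (liftY f (E : 𝔸))),
            ⨆ μ : Fin (d + 1), l2OfY hh (cdS i U μ (O U (liftY f (E : 𝔸)))),
            ⨆ μ : Fin (d + 1), l2OfY hh (O U (cdsS i U μ (liftY f (E : 𝔸)))),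
            ⨆ μ : Fin (d + 1), ⨆ ν : Fin (d + 1), l2OfY hh (cdS i U μ (O U (cdsS i U ν (liftY f (E : 𝔸))))),
            ⨆ μ : Fin (d + 1), ⨆ ν : Fin (d + 1), l2OfY hh (cdS i U μ (cdS i U ν (O U (liftY f (E : 𝔸))))),
            ⨆ μ : Fin (d + 1), ⨆ ν : Fin (d + 1), l2OfY hh (O U (cdsS i U μ (cdsS i U ν (liftY f (E : 𝔸)))))] : Fin 6 → ℝ) n)
    | _, _ => 0
  glob := fun n U' lam γ => let U := cfg U'; match lam with
    | .inl f => ⨆ E : BallY 𝔸,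
        ((![wNormSY i (2 + γ) (fun z => ((etaS i ^ 2 : ℝ) : ℂ) • O U (liftY f (E : 𝔸)) z),
            ⨆ μ : Fin (d + 1), wNormSY i (1 + γ) (fun z => ((etaS i : ℝ) : ℂ) • cdS i U μ (O U (liftY f (E : 𝔸))) z),
            ⨆ μ : Fin (d + 1), wNormSY i (1 + γ) (fun z => ((etaS i : ℝ) : ℂ) • O U (cdsS i U μ (liftY f (E : 𝔸))) z),
            wNormSY i γ (lapS i U (O U (liftY f (E : 𝔸))))] : Fin 4 → ℝ) n)
    | .inr _ => 0

/-! ### §3.2 The `B9.KernelFamily` of a bond-sector letter (G(U), 𝔾_D, G₁, 𝔾, G(Ω) − G(Ω′)): ON `.inr`, `0` OFF -/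

open Classical in
/-- **THE `B9.KernelFamily` READING OF A BOND-SECTOR LETTER** (r03's `kG` shapes with `‖·‖`, covariant differences in physical units `c_f`, the
transporter in the Hölder quotients, and the outer sup over the unit ball): ON `.inr J` (`Λ = J ⊗ E`), `0` OFF.
[cite: Balaban1985BackgroundPropagators, Thm 3.3 p.399 + (3.42)–(3.47) pp.397–398] -/
def kernelFamilyB (B : B9.Backgrounds) (cfg : B.Cfg → CfgY 𝔸 i) (O : BondOpY 𝔸 i) (par : BondParY 𝔸 i) :
    B9.KernelFamily (B9GeoNormsKLevelV1.geo9K i) B where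
  e := fun n U' lam b => let U := cfg U'; match lam with
    | .inr J => ⨆ E : BallY 𝔸,
        ((![supInB i (β i.hN i.D i.hk b) (O U (liftY J (E : 𝔸))),
            ⨆ ν : Fin (d + 1), supInB i (β i.hN i.D i.hk b) (cdB i U ν (O U (liftY J (E : 𝔸)))),
            ⨆ ν : Fin (d + 1), supInB i (β i.hN i.D i.hk b) (O U (cdsB i U ν (liftY J (E : 𝔸)))),
            supInB i (β i.hN i.D i.hk b) (lapB i U (O U (liftY J (E : 𝔸))))] : Fin 4 → ℝ) n)
    | .inl _ => 0
  h1 := fun U' lam α ζ => let U := cfg U'; match lam, ζ with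
    | .inr J, .inr z => ⨆ E : BallY 𝔸,
        max (⨆ ν : Fin (d + 1), holderQB i (par U) α z (cdB i U ν (O U (liftY J (E : 𝔸)))))
          (⨆ ν : Fin (d + 1), holderQB i (par U) α z (O U (cdsB i U ν (liftY J (E : 𝔸)))))
    | _, _ => 0
  e4 := fun U' lam b => let U := cfg U'; match lam with
    | .inr J => ⨆ E : BallY 𝔸, ⨆ ν : Fin (d + 1), ⨆ μ : Fin (d + 1),
        supInB i (β i.hN i.D i.hk b) (cdB i U ν (O U (cdsB i U μ (liftY J (E : 𝔸)))))
    | .inl _ => 0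
  h2 := fun U' lam α ζ => let U := cfg U'; match lam, ζ with
    | .inr J, .inr z => ⨆ E : BallY 𝔸, ⨆ ν : Fin (d + 1), ⨆ μ : Fin (d + 1),
        holderQB i (par U) α z (cdB i U ν (O U (cdsB i U μ (liftY J (E : 𝔸)))))
    | _, _ => 0
  l2 := fun n U' lam h => let U := cfg U'; match lam, h with
    | .inr J, .inr hh => ⨆ E : BallY 𝔸,
        ((![l2OfY hh (O U (liftY J (E : 𝔸))),
            ⨆ ν : Fin (d + 1), l2OfY hh (cdB i U ν (O U (liftY J (E : 𝔸)))),
            ⨆ ν : Fin (d + 1), l2OfY hh (O U (cdsB i U ν (liftY J (E : 𝔸)))),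
            ⨆ ν : Fin (d + 1), ⨆ μ : Fin (d + 1), l2OfY hh (cdB i U ν (O U (cdsB i U μ (liftY J (E : 𝔸))))),
            ⨆ ν : Fin (d + 1), ⨆ μ : Fin (d + 1), l2OfY hh (cdB i U ν (cdB i U μ (O U (liftY J (E : 𝔸))))),
            ⨆ ν : Fin (d + 1), ⨆ μ : Fin (d + 1), l2OfY hh (O U (cdsB i U ν (cdsB i U μ (liftY J (E : 𝔸)))))] : Fin 6 → ℝ) n)
    | _, _ => 0
  glob := fun n U' lam γ => let U := cfg U'; match lam with
    | .inr J => ⨆ E : BallY 𝔸,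
        ((![wNormBY i (2 + γ) (O U (liftY J (E : 𝔸))),
            ⨆ ν : Fin (d + 1), wNormBY i (1 + γ) (cdB i U ν (O U (liftY J (E : 𝔸)))),
            ⨆ ν : Fin (d + 1), wNormBY i (1 + γ) (O U (cdsB i U ν (liftY J (E : 𝔸)))),
            wNormBY i γ (lapB i U (O U (liftY J (E : 𝔸))))] : Fin 4 → ℝ) n)
    | .inl _ => 0

/-! ### §3.3 Two-point kernels: `B9.SiteKernel` (3.48)∕(3.132)∕(3.187), `B9.HKernel` (3.133), `B9.FineKernel` (3.49) -/

/-- **THE `B9.SiteKernel` READING of a letter between coarse function spaces**: `|K(y, y′)| := sup_E ‖(O(U)(δ_{y′} ⊗ E))(y)‖` with the coarse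
points read through `ix ∕ iy` (blocks `β` for (Q′G′²Q′*)⁻¹ and C^{(k)}, the index bonds themselves for (QGQ*)⁻¹, (QG₁Q*)⁻¹).
[cite: Balaban1985BackgroundPropagators, (3.48) p.398, (3.132) p.422, (3.187) p.432] -/
def siteKernelOfOp (B : B9.Backgrounds) (cfg : B.Cfg → CfgY 𝔸 i) {X Y : Type} (O : CfgY 𝔸 i → (Y → 𝔸) →ₗ[ℂ] (X → 𝔸))
    (ix : IBondY i → X) (iy : IBondY i → Y) : B9.SiteKernel (B9GeoNormsKLevelV1.geo9K i) B :=
  ⟨fun U b b' => ⨆ E : BallY 𝔸, ‖O (cfg U) (deltaY (iy b') (E : 𝔸)) (ix b)‖⟩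

open Classical in
/-- **THE `B9.HKernel` READING (3.133) of a letter `H(U)` from coarse-bond functions to fine-bond functions** (r03's `kH` shapes: the block
volume normalisation `(vol c)⁻¹`, the sup over `x ∈ Δ(y)` and the direction, the admissible Hölder pairs; covariant differences; outer sup over E).
[cite: Balaban1985BackgroundPropagators, (3.133) p.422] -/
def hKernelOfOp (B : B9.Backgrounds) (cfg : B.Cfg → CfgY 𝔸 i) (O : CfgY 𝔸 i → (IBondY i → 𝔸) →ₗ[ℂ] (FBondY i → 𝔸)) (par : BondParY 𝔸 i) :
    B9.HKernel (B9GeoNormsKLevelV1.geo9K i) B where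
  e := fun n U' y c => let U := cfg U'; ⨆ E : BallY 𝔸, ⨆ ν : Fin (d + 1), ⨆ f : FBondY i,
    if blkV1 i.hN i.D f = β i.hN i.D i.hk y then
      (if n = 0 then ‖O U (deltaY c (E : 𝔸)) f‖ else ‖cdB i U ν (O U (deltaY c (E : 𝔸))) f‖) * (vol i c)⁻¹ else 0
  h := fun U' α ζ c => let U := cfg U'; match ζ with
    | .inr z => ⨆ E : BallY 𝔸, ⨆ ν : Fin (d + 1), holderQB i (par U) α z (cdB i U ν (O U (deltaY c (E : 𝔸)))) * (vol i c)⁻¹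
    | .inl _ => 0

/-- **THE `B9.FineKernel` READING (3.49) of a bond-sector letter `P(U)`**: for coarse `y, y′` the sups over `x ∈ Δ(y)`, `x′ ∈ Δ(y′)` (and the
directions) of `‖P(x, x′)‖, ‖(∇_U P)_μ(x, x′)‖, ‖(P∇*_U)_ν(x, x′)‖, ‖(∇_U P ∇*_U)_{μν}(x, x′)‖`, kernel entries as values on `δ_{x′} ⊗ E`.
[cite: Balaban1985BackgroundPropagators, (3.49) p.399] -/
def fineKernelOfOp (B : B9.Backgrounds) (cfg : B.Cfg → CfgY 𝔸 i) (O : BondOpY 𝔸 i) : B9.FineKernel (B9GeoNormsKLevelV1.geo9K i) B :=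
  ⟨fun n U' y y' => let U := cfg U'; ⨆ E : BallY 𝔸, ⨆ x' : {x : FBondY i // blkV1 i.hN i.D x = β i.hN i.D i.hk y'},
    ((![supInB i (β i.hN i.D i.hk y) (O U (deltaY x'.1 (E : 𝔸))),
        ⨆ μ : Fin (d + 1), supInB i (β i.hN i.D i.hk y) (cdB i U μ (O U (deltaY x'.1 (E : 𝔸)))),
        ⨆ ν : Fin (d + 1), supInB i (β i.hN i.D i.hk y) (O U (cdsB i U ν (deltaY x'.1 (E : 𝔸)))),
        ⨆ μ : Fin (d + 1), ⨆ ν : Fin (d + 1), supInB i (β i.hN i.D i.hk y) (cdB i U μ (O U (cdsB i U ν (deltaY x'.1 (E : 𝔸)))))] :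
      Fin 4 → ℝ) n)⟩

end Reading

/-! ## §4 The letter interfaces at a member -/

section Letters

variable (𝔸) (G : Subgroup 𝔸ˣ)

/-- **BAŁABAN'S COVARIANT LETTERS AT A MEMBER, AS FUNCTIONS OF THE BACKGROUND** — the INTERFACE the operator layer is read from.  Operator-valued
fields (ℂ-linear maps of `𝔸`-valued lattice functions, one per `U`): `parS ∕ parB` the parallel transporters `U(Γ_{z,z′})` of (3.40) (site ∕ torus
carriers); `Gp` = G′(U) (3.25); `GA` = G(U) (3.27); `C` = (Q′(U)G′²(U)Q′*(U))⁻¹ (3.48) on block functions; `GD` = 𝔾_D(U), `G₁` = G₁(U) (3.129), `GG` = 𝔾(U)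
(3.145), `Kdiff` = G(Ω, U) − G(Ω′, U) (Thm 3.14), `P349` = P = I − R (3.49) on fine-bond functions; `H ∕ H₁` = GQ*(QGQ*)⁻¹ (3.126)∕(3.129) from coarse-bond
to fine-bond functions; `Ck` = C^{(k)}(Λ, U) (3.187) on block functions; `QGQinv ∕ QG1Qinv` = (QGQ*)⁻¹, (QG₁Q*)⁻¹ (3.132) on coarse-bond functions.
`Prop`-valued fields = THE PRINTED `U = 1` CLAUSES (p. 395 «It coincides with Δ_a in (2.19) if U = 1»; Cor. 3.5 p. 407 «for U = 1 these theorems are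
proved in [4]»): at `U = 1` the transporters are `1` and G′, G, C act on product-form arguments as the lifts of NODE 00's genuine [B6] operators of
record (`KTIdx.G = gmlT …` = (Δ′_a)⁻¹ of (2.19), r03's `Gop = Δ_a⁻¹` of (2.129), T8's `CinvTP` kernel of (2.86)).  A PARAMETER RECORD: the construction
of an instance from (3.14)–(3.27) over the member's domains is the successor item `lettersYOfRecord`.
[cite: Balaban1985BackgroundPropagators, (3.25), (3.27) p.395, (3.40) p.397, (3.48) p.398, (3.49) p.399, (3.126)–(3.132) pp.421–422, (3.187) p.432; p.395 + Cor. 3.5 p.407 (U = 1 clauses)] -/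
structure CovLettersY (x : MemberY d ℓ hd hL b₀ b₁ Mstar) where
  parS : SiteParY 𝔸 x.toKIdx
  parB : BondParY 𝔸 x.toKIdx
  Gp : SiteOpY 𝔸 x.toKIdx
  GA : BondOpY 𝔸 x.toKIdx
  C : CfgY 𝔸 x.toKIdx → (BlkY x.toKIdx → 𝔸) →ₗ[ℂ] (BlkY x.toKIdx → 𝔸)
  GD : BondOpY 𝔸 x.toKIdx
  G₁ : BondOpY 𝔸 x.toKIdx
  GG : BondOpY 𝔸 x.toKIdx
  Kdiff : BondOpY 𝔸 x.toKIdx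
  H : CfgY 𝔸 x.toKIdx → (IBondY x.toKIdx → 𝔸) →ₗ[ℂ] (FBondY x.toKIdx → 𝔸)
  H₁ : CfgY 𝔸 x.toKIdx → (IBondY x.toKIdx → 𝔸) →ₗ[ℂ] (FBondY x.toKIdx → 𝔸)
  Ck : CfgY 𝔸 x.toKIdx → (BlkY x.toKIdx → 𝔸) →ₗ[ℂ] (BlkY x.toKIdx → 𝔸)
  QGQinv : CfgY 𝔸 x.toKIdx → (IBondY x.toKIdx → 𝔸) →ₗ[ℂ] (IBondY x.toKIdx → 𝔸)
  QG1Qinv : CfgY 𝔸 x.toKIdx → (IBondY x.toKIdx → 𝔸) →ₗ[ℂ] (IBondY x.toKIdx → 𝔸)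
  P349 : BondOpY 𝔸 x.toKIdx
  parS_one : ∀ z z', parS (fun _ _ => 1) z z' = 1
  parB_one : ∀ s s', parB (fun _ _ => 1) s s' = 1
  Gp_one : ∀ (f : SiteY x.toKIdx → ℝ) (E : 𝔸), Gp (fun _ _ => 1) (liftY f E) = liftY ((toKT x.toKIdx).G *ᵥ f) E
  GA_one : ∀ (J : FBondY x.toKIdx → ℝ) (E : 𝔸), GA (fun _ _ => 1) (liftY J E) = liftY (B6Prop26Census2136KLevelV1.Gop x.toKIdx J) E
  C_one : ∀ (s s' : BlkY x.toKIdx) (E : 𝔸),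
    C (fun _ _ => 1) (deltaY s' E) s = (((B6Prop23KLevelTorusCensus.CinvTP (toKT x.toKIdx)).ker s s' : ℝ) : ℂ) • E

/-- **THE PREDICATE ∕ EXPANSION LETTERS AT A MEMBER** — the ten fields of `OperatorLayerY` that are not norm functionals of an operator: the
analyticity predicate (3.37)∕(3.38), the random-walk expansions of Thm 3.7 ∕ Thm 3.9 ∕ Thm 3.10 ((3.90)–(3.108)), the positivity clauses of Thm 3.11,
the expansion predicates of Thms 3.12–3.13, (3.185) and the C^{(k)} expansion of Thm 3.15 — instantiated downstream by the n06-c ∕ n06-d pins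
(`B9Thm37Whole.E37OfOps`, `W38OfOps`, …).  A PARAMETER RECORD. [cite: Balaban1985BackgroundPropagators, (3.37) p.396, Thms 3.7–3.15 pp.409–432] -/
structure ExpLettersY (x : MemberY d ℓ hd hL b₀ b₁ Mstar) where
  IsAnalyticExt : B9.KernelFamily (geo9Y x) (bg9Y 𝔸 G x) → (bg9Y 𝔸 G x).Cfg → ℝ → Prop
  E37 : B9.RWExpansion (geo9Y x) (bg9Y 𝔸 G x)
  EK39 : B9.RWKernelExpansion (geo9Y x) (bg9Y 𝔸 G x)
  E310 : B9.RWExpansion (geo9Y x) (bg9Y 𝔸 G x)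
  PosDef : Fin 5 → (bg9Y 𝔸 G x).Cfg → Prop
  HasRWExp : B9.KernelFamily (geo9Y x) (bg9Y 𝔸 G x) → (bg9Y 𝔸 G x).Cfg → ℝ → Prop
  HasRWExpH : B9.HKernel (geo9Y x) (bg9Y 𝔸 G x) → (bg9Y 𝔸 G x).Cfg → ℝ → Prop
  PosDefK : B9.KernelFamily (geo9Y x) (bg9Y 𝔸 G x) → (bg9Y 𝔸 G x).Cfg → Prop
  GivenBy3185 : (bg9Y 𝔸 G x).Cfg → Prop
  HasRWExpC : (bg9Y 𝔸 G x).Cfg → ℝ → Prop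

end Letters

/-! ## §5 The instance: the operator layer read from the letters -/

section Instance

variable (𝔸) (G : Subgroup 𝔸ˣ)

/-- **THE OPERATOR LAYER AT A MEMBER, READ FROM THE LETTERS**: the fourteen operator-valued fields of `OperatorLayerY` are the §3 readings of the
corresponding letters of `𝔏` (site sector: `Gp`; bond sector: `GA GD G₁ GG Kdiff`, fine kernel `P349`; two-point: `Cinv Ck` at the carrier blocks
`β`, `QGQinv QG1Qinv` at the index bonds; `H H₁`), the ten predicate ∕ expansion fields are `𝔈`'s.  (`geo9Y x = geo9K x.toKIdx` and `(bg9Y 𝔸 G x).Cfg =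
CfgV1 …` definitionally.) [cite: Balaban1985BackgroundPropagators, Thms 3.1–3.15 pp.397–432 (the operators the statements are about)] -/
def operatorLayerYOfLetters (x : MemberY d ℓ hd hL b₀ b₁ Mstar) (𝔏 : CovLettersY 𝔸 x) (𝔈 : ExpLettersY 𝔸 G x) :
    OperatorLayerY d ℓ hd hL b₀ b₁ Mstar 𝔸 G x where
  Gp := kernelFamilyS x.toKIdx (bg9Y 𝔸 G x) (fun U => U) 𝔏.Gp 𝔏.parS
  GA := kernelFamilyB x.toKIdx (bg9Y 𝔸 G x) (fun U => U) 𝔏.GA 𝔏.parB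
  Cinv := siteKernelOfOp x.toKIdx (bg9Y 𝔸 G x) (fun U => U) 𝔏.C (β x.hN x.D x.hk) (β x.hN x.D x.hk)
  IsAnalyticExt := 𝔈.IsAnalyticExt
  E37 := 𝔈.E37
  EK39 := 𝔈.EK39
  E310 := 𝔈.E310
  PosDef := 𝔈.PosDef
  GD := kernelFamilyB x.toKIdx (bg9Y 𝔸 G x) (fun U => U) 𝔏.GD 𝔏.parB
  G₁ := kernelFamilyB x.toKIdx (bg9Y 𝔸 G x) (fun U => U) 𝔏.G₁ 𝔏.parB
  H := hKernelOfOp x.toKIdx (bg9Y 𝔸 G x) (fun U => U) 𝔏.H 𝔏.parB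
  H₁ := hKernelOfOp x.toKIdx (bg9Y 𝔸 G x) (fun U => U) 𝔏.H₁ 𝔏.parB
  HasRWExp := 𝔈.HasRWExp
  HasRWExpH := 𝔈.HasRWExpH
  PosDefK := 𝔈.PosDefK
  GG := kernelFamilyB x.toKIdx (bg9Y 𝔸 G x) (fun U => U) 𝔏.GG 𝔏.parB
  Kdiff := kernelFamilyB x.toKIdx (bg9Y 𝔸 G x) (fun U => U) 𝔏.Kdiff 𝔏.parB
  Ck := siteKernelOfOp x.toKIdx (bg9Y 𝔸 G x) (fun U => U) 𝔏.Ck (β x.hN x.D x.hk) (β x.hN x.D x.hk)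
  GivenBy3185 := 𝔈.GivenBy3185
  HasRWExpC := 𝔈.HasRWExpC
  P349 := fineKernelOfOp x.toKIdx (bg9Y 𝔸 G x) (fun U => U) 𝔏.P349
  QGQinv := siteKernelOfOp x.toKIdx (bg9Y 𝔸 G x) (fun U => U) 𝔏.QGQinv id id
  QG1Qinv := siteKernelOfOp x.toKIdx (bg9Y 𝔸 G x) (fun U => U) 𝔏.QG1Qinv id id

end Instance

section Record

open scoped Matrix.Norms.L2Operator

/-- the letters of the record's carriers: `𝔸 = Matrix (Fin N) (Fin N) ℂ` (L²-operator norm), one `CovLettersY` per member of Stage 3′(Y).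
[cite: Balaban1985BackgroundPropagators, (3.25)–(3.27) p.395, dictionary] -/
abbrev LettersY (N : ℕ) (θ : Stage3Params) (Mstar : ℕ) : Type :=
  ∀ x : MemberY θ.d₆ θ.ℓ₆ θ.hd' θ.hL' θ.b₀ θ.b₁ Mstar, CovLettersY (Matrix (Fin N) (Fin N) ℂ) x

/-- the predicate ∕ expansion letters of the record's carriers (`G = SU(N)`). [cite: Balaban1985BackgroundPropagators, Thms 3.7–3.15 pp.409–432, dictionary] -/
abbrev ExpsY (N : ℕ) (θ : Stage3Params) (Mstar : ℕ) : Type 1 :=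
  ∀ x : MemberY θ.d₆ θ.ℓ₆ θ.hd' θ.hL' θ.b₀ θ.b₁ Mstar, ExpLettersY (Matrix (Fin N) (Fin N) ℂ) (specialUnitaryUnits (Fin N)) x

/-- ★ **THE `OpsY` INSTANCE OF STAGE 3′(Y) AS A FUNCTION OF BAŁABAN'S LETTERS**: `opsYOfLetters N θ M⋆ 𝔏 𝔈 : OpsY N θ M⋆`, member by member the
layer `operatorLayerYOfLetters`.  Every N06 leaf ∕ obligation of `BalabanUVNodesN06AtRecord11CB10YZW` instantiates at `ops := opsYOfLetters N θ M⋆ 𝔏 𝔈`.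
[cite: Balaban1985BackgroundPropagators, Thms 3.1–3.15 pp.397–432] -/
def opsYOfLetters (N : ℕ) (θ : Stage3Params) (Mstar : ℕ) (𝔏 : LettersY N θ Mstar) (𝔈 : ExpsY N θ Mstar) : OpsY N θ Mstar :=
  fun x => operatorLayerYOfLetters (Matrix (Fin N) (Fin N) ℂ) (specialUnitaryUnits (Fin N)) x (𝔏 x) (𝔈 x)

/-- the [B9] bundle of record at the instance. [cite: Balaban1985BackgroundPropagators, Thms 3.1–3.15 pp.397–432, bookkeeping] -/
theorem Y9OfRecord_opsYOfLetters (N : ℕ) (θ : Stage3Params) (Mstar : ℕ) (𝔏 : LettersY N θ Mstar) (𝔈 : ExpsY N θ Mstar) :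
    Y9OfRecord N θ Mstar (opsYOfLetters N θ Mstar 𝔏 𝔈) =
      carriersY θ.d₆ θ.ℓ₆ θ.hd' θ.hL' θ.b₀ θ.b₁ Mstar (Matrix (Fin N) (Fin N) ℂ) (specialUnitaryUnits (Fin N)) (opsYOfLetters N θ Mstar 𝔏 𝔈) := rfl

end Record

/-! ## §6 Unfolding lemmas for the N06 seats (the ON∕OFF shape and the `U = 1` pattern) -/

section Unfold

variable {G : Subgroup 𝔸ˣ} (x : MemberY d ℓ hd hL b₀ b₁ Mstar) (𝔏 : CovLettersY 𝔸 x) (𝔈 : ExpLettersY 𝔸 G x)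

/-- `Gp` of the layer IS the site-sector reading of the letter G′(U). [cite: Balaban1985BackgroundPropagators, Thm 3.1 p.397, bookkeeping] -/
theorem operatorLayerYOfLetters_Gp : (operatorLayerYOfLetters 𝔸 G x 𝔏 𝔈).Gp = kernelFamilyS x.toKIdx (bg9Y 𝔸 G x) (fun U => U) 𝔏.Gp 𝔏.parS := rfl
/-- `GA` IS the bond-sector reading of G(U). [cite: Balaban1985BackgroundPropagators, Thm 3.3 p.399, bookkeeping] -/
theorem operatorLayerYOfLetters_GA : (operatorLayerYOfLetters 𝔸 G x 𝔏 𝔈).GA = kernelFamilyB x.toKIdx (bg9Y 𝔸 G x) (fun U => U) 𝔏.GA 𝔏.parB := rfl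
/-- `Cinv` IS the block-kernel reading of (Q′G′²Q′*)⁻¹(U). [cite: Balaban1985BackgroundPropagators, Thm 3.2 (3.48) p.398, bookkeeping] -/
theorem operatorLayerYOfLetters_Cinv :
    (operatorLayerYOfLetters 𝔸 G x 𝔏 𝔈).Cinv = siteKernelOfOp x.toKIdx (bg9Y 𝔸 G x) (fun U => U) 𝔏.C (β x.hN x.D x.hk) (β x.hN x.D x.hk) := rfl
/-- `E37` IS the expansion letter. [cite: Balaban1985BackgroundPropagators, Thm 3.7 p.409, bookkeeping] -/
theorem operatorLayerYOfLetters_E37 : (operatorLayerYOfLetters 𝔸 G x 𝔏 𝔈).E37 = 𝔈.E37 := rfl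

/-- OFF the site summand `Gp.e` reads `0` (bond arguments). [cite: Balaban1985BackgroundPropagators, Thm 3.1 p.397 (λ scalar), bookkeeping] -/
theorem Gp_e_inr (n : Fin 4) (U : (bg9Y 𝔸 G x).Cfg) (J : FBondY x.toKIdx → ℝ) (b : (geo9Y x).Site) :
    (operatorLayerYOfLetters 𝔸 G x 𝔏 𝔈).Gp.e n U (Sum.inr J) b = 0 := rfl
/-- OFF the bond summand `GA.e` reads `0` (site arguments). [cite: Balaban1985BackgroundPropagators, Thm 3.3 p.399 (λ vector), bookkeeping] -/
theorem GA_e_inl (n : Fin 4) (U : (bg9Y 𝔸 G x).Cfg) (f : SiteY x.toKIdx → ℝ) (b : (geo9Y x).Site) :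
    (operatorLayerYOfLetters 𝔸 G x 𝔏 𝔈).GA.e n U (Sum.inl f) b = 0 := rfl
/-- OFF the bond summand `GA.e4` reads `0`. [cite: Balaban1985BackgroundPropagators, (3.44) p.398, bookkeeping] -/
theorem GA_e4_inl (U : (bg9Y 𝔸 G x).Cfg) (f : SiteY x.toKIdx → ℝ) (b : (geo9Y x).Site) :
    (operatorLayerYOfLetters 𝔸 G x 𝔏 𝔈).GA.e4 U (Sum.inl f) b = 0 := rfl
/-- OFF the bond summand `GA.h2` reads `0`. [cite: Balaban1985BackgroundPropagators, (3.45) p.398, bookkeeping] -/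
theorem GA_h2_inl (U : (bg9Y 𝔸 G x).Cfg) (f : SiteY x.toKIdx → ℝ) (α : ℝ) (ζ : (geo9Y x).Cut) :
    (operatorLayerYOfLetters 𝔸 G x 𝔏 𝔈).GA.h2 U (Sum.inl f) α ζ = 0 := by
  cases ζ <;> rfl

/-- ON the site summand at `U = 1`, entry `e 0` unfolded: `η²·sup_E sup_{z ∈ Δ(β b)} ‖(G′(1)(f ⊗ E))(z)‖`. [cite: Balaban1985BackgroundPropagators, (3.42) p.397, Cor. 3.5 p.407, bookkeeping] -/
theorem Gp_e0_inl (U : (bg9Y 𝔸 G x).Cfg) (f : SiteY x.toKIdx → ℝ) (b : (geo9Y x).Site) :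
    (operatorLayerYOfLetters 𝔸 G x 𝔏 𝔈).Gp.e 0 U (Sum.inl f) b =
      etaS x.toKIdx ^ 2 * ⨆ E : BallY 𝔸, supBlkS x.toKIdx (β x.hN x.D x.hk b) (𝔏.Gp U (liftY f (E : 𝔸))) := rfl

/-- a sup over the unit ball of quantities each `≤ a` (`0 ≤ a`) is `≤ a` — the outer step of every `U = 1` comparison. [cite: Balaban1985BackgroundPropagators, (3.39) p.397 (the supremum over directions), bookkeeping] -/
theorem iSup_ball_le {F : BallY 𝔸 → ℝ} {a : ℝ} (h : ∀ E, F E ≤ a) (ha : 0 ≤ a) : (⨆ E, F E) ≤ a := Real.iSup_le h ha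

/-- monotonicity of NODE 00's localised sups over a finite carrier: termwise domination ON the block gives domination of the sups (any two
decidability instances). [cite: Balaban1984PropagatorsII, (2.67) p.234 (the localised sup), bookkeeping] -/
theorem iSup_ite_le_iSup_ite {X : Type} [Finite X] (p : X → Prop) (d₁ d₂ : DecidablePred p) {u v : X → ℝ} (h : ∀ z, p z → u z ≤ v z)
    (hv : ∀ z, 0 ≤ v z) : (⨆ z, @ite _ (p z) (d₁ z) (u z) 0) ≤ ⨆ z, @ite _ (p z) (d₂ z) (v z) 0 := by
  have hv' : ∀ z, 0 ≤ @ite _ (p z) (d₂ z) (v z) 0 := fun z => by split_ifs <;> simp [hv]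
  refine Real.iSup_le (fun z => ?_) (Real.iSup_nonneg hv')
  refine le_trans ?_ (le_ciSup (Set.finite_range _).bddAbove z)
  split_ifs with hz
  · exact h z hz
  · exact le_rfl

/-- **THE `U = 1` PATTERN, ENTRY (3.42)₁ ∕ (2.67)₁** (a worked instance for the N06 comparison seats): with the printed flatness clause `Gp_one`, the
reading's `e 0` at `U = 1` is dominated by NODE 00's `(GpU i).e 0` — `‖(G′(1)(f ⊗ E))(z)‖ = |(G′f)(z)|‖E‖ ≤ |(G′f)(z)|`.
[cite: Balaban1985BackgroundPropagators, Cor. 3.5 p.407 («for U = 1 these theorems are proved in [4]»)] -/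
theorem Gp_e0_one_le (f : SiteY x.toKIdx → ℝ) (b : (geo9Y x).Site) :
    (operatorLayerYOfLetters 𝔸 G x 𝔏 𝔈).Gp.e 0 (bg9Y 𝔸 G x).one (Sum.inl f) b ≤ (GpU x.toKIdx).e 0 (Sum.inl f) b := by
  show etaS x.toKIdx ^ 2 * (⨆ E : BallY 𝔸, supBlkS x.toKIdx (β x.hN x.D x.hk b) (𝔏.Gp (fun _ _ => 1) (liftY f (E : 𝔸)))) ≤
    ((((nKT (toKT x.toKIdx) : ℕ) : ℝ))⁻¹) ^ (epow 0) * (toKT x.toKIdx).gp.e 0 f (β x.hN x.D x.hk b)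
  have h0 : epow 0 = 2 := rfl
  rw [h0]
  refine mul_le_mul_of_nonneg_left ?_ (pow_nonneg (inv_nonneg.2 (Nat.cast_nonneg _)) _)
  have hnn : 0 ≤ (toKT x.toKIdx).gp.e 0 f (β x.hN x.D x.hk b) := by
    show 0 ≤ (toKT x.toKIdx).e0 f (β x.hN x.D x.hk b)
    exact Real.iSup_nonneg fun z => by
      classical
      split_ifs <;> simp
  refine iSup_ball_le (fun E => ?_) hnn
  show supBlkS x.toKIdx (β x.hN x.D x.hk b) (𝔏.Gp (fun _ _ => 1) (liftY f (E : 𝔸))) ≤ (toKT x.toKIdx).e0 f (β x.hN x.D x.hk b)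
  rw [𝔏.Gp_one]
  unfold supBlkS KTIdx.e0
  classical
  exact iSup_ite_le_iSup_ite (X := SiteY x.toKIdx) _ _ _ (fun z _ => norm_liftY_le _ E z) (fun z => abs_nonneg _)

end Unfold

/-! ## §7 Non-vacuity of the interface: the FLAT letters (honest: not Bałaban's) -/

section Flat

variable (𝔸) (G : Subgroup 𝔸ˣ) (x : MemberY d ℓ hd hL b₀ b₁ Mstar)

/-- the ℂ-linear lift of a real matrix to `𝔸`-valued functions: `(A♯Λ)(z) = Σ_w A z w • Λ w`. [folklore] -/
def liftOpY {X : Type} [Fintype X] (A : Matrix X X ℝ) : (X → 𝔸) →ₗ[ℂ] (X → 𝔸) where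
  toFun Λ := fun z => ∑ w, ((A z w : ℝ) : ℂ) • Λ w
  map_add' Λ Λ' := by
    funext z
    simp [smul_add, Finset.sum_add_distrib]
  map_smul' c Λ := by
    funext z
    simp [Finset.smul_sum, smul_comm c]

omit [CompleteSpace 𝔸] in
/-- the lift acts on product-form arguments as the matrix: `A♯(f ⊗ E) = (A f) ⊗ E`. [cite: Balaban1985BackgroundPropagators, p.395 («It coincides with Δ_a in (2.19) if U = 1»), bookkeeping] -/
theorem liftOpY_liftY {X : Type} [Fintype X] (A : Matrix X X ℝ) (f : X → ℝ) (E : 𝔸) :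
    liftOpY 𝔸 A (liftY f E) = liftY (A *ᵥ f) E := by
  funext z
  simp only [liftOpY, LinearMap.coe_mk, AddHom.coe_mk, liftY_apply, Matrix.mulVec, dotProduct]
  rw [show (((∑ w, A z w * f w : ℝ)) : ℂ) = ∑ w, ((A z w : ℝ) : ℂ) * ((f w : ℝ) : ℂ) by push_cast; rfl, Finset.sum_smul]
  refine Finset.sum_congr rfl fun w _ => ?_
  rw [mul_smul]

/-- the ℂ-linear lift of a real linear endomorphism of functions on a finite type (through its matrix). [folklore] -/
def liftEndY {X : Type} [Fintype X] [DecidableEq X] (T : Module.End ℝ (X → ℝ)) : (X → 𝔸) →ₗ[ℂ] (X → 𝔸) :=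
  liftOpY 𝔸 (LinearMap.toMatrix' T)

omit [CompleteSpace 𝔸] in
/-- the lift of an endomorphism acts on product-form arguments as the endomorphism. [cite: Balaban1985BackgroundPropagators, p.395 («It coincides with Δ_a in (2.19) if U = 1»), bookkeeping] -/
theorem liftEndY_liftY {X : Type} [Fintype X] [DecidableEq X] (T : Module.End ℝ (X → ℝ)) (f : X → ℝ) (E : 𝔸) :
    liftEndY 𝔸 T (liftY f E) = liftY (T f) E := by
  rw [liftEndY, liftOpY_liftY, LinearMap.toMatrix'_mulVec]

open Classical in
/-- the block kernel letter with a prescribed real kernel: `(K♭Λ)(s) = Σ_{s′} k(s, s′) • Λ(s′)`. [folklore] -/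
def kernelOpY {X : Type} [Fintype X] (k : X → X → ℝ) : (X → 𝔸) →ₗ[ℂ] (X → 𝔸) := liftOpY 𝔸 (Matrix.of k)

omit [CompleteSpace 𝔸] in
open Classical in
/-- the kernel letter on a delta: `(K♭(δ_{s′} ⊗ E))(s) = k(s, s′) • E`. [cite: Balaban1985BackgroundPropagators, (3.48) p.398, bookkeeping] -/
theorem kernelOpY_deltaY {X : Type} [Fintype X] (k : X → X → ℝ) (s s' : X) (E : 𝔸) :
    kernelOpY 𝔸 k (deltaY s' E) s = ((k s s' : ℝ) : ℂ) • E := by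
  simp only [kernelOpY, liftOpY, LinearMap.coe_mk, AddHom.coe_mk, deltaY, Matrix.of_apply, smul_ite, smul_zero]
  rw [Finset.sum_ite_eq' Finset.univ s']
  simp

open Classical in
/-- **THE FLAT LETTERS** — every transporter `1`, G′(U) := the lift of NODE 00's `KTIdx.G` for ALL `U`, G(U) := the lift of r03's `Gop`, C(U) := the
block kernel of T8's `CinvTP`, the Sect. D∕E letters `0`.  They satisfy the interface's `U = 1` clauses (trivially, being `U`-independent); they are
NOT Bałaban's letters (no `U`-dependence) — recorded only so that the interface is visibly inhabited.
[cite: Balaban1985BackgroundPropagators, p.395 + Cor. 3.5 p.407 (the U = 1 clauses), bookkeeping (non-vacuity)] -/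
def covLettersY_flat : CovLettersY 𝔸 x where
  parS := fun _ _ _ => 1
  parB := fun _ _ _ => 1
  Gp := fun _ => liftOpY 𝔸 (toKT x.toKIdx).G
  GA := fun _ => liftEndY 𝔸 (B6Prop26Census2136KLevelV1.Gop x.toKIdx)
  C := fun _ => kernelOpY 𝔸 (B6Prop23KLevelTorusCensus.CinvTP (toKT x.toKIdx)).ker
  GD := fun _ => 0
  G₁ := fun _ => 0
  GG := fun _ => 0
  Kdiff := fun _ => 0
  H := fun _ => 0
  H₁ := fun _ => 0
  Ck := fun _ => 0
  QGQinv := fun _ => 0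
  QG1Qinv := fun _ => 0
  P349 := fun _ => 0
  parS_one := fun _ _ => rfl
  parB_one := fun _ _ => rfl
  Gp_one := fun f E => liftOpY_liftY 𝔸 _ f E
  GA_one := fun J E => liftEndY_liftY 𝔸 _ J E
  C_one := fun s s' E => kernelOpY_deltaY 𝔸 _ s s' E

/-- the letter interface is inhabited at every member. [cite: Balaban1985BackgroundPropagators, p.395, bookkeeping (non-vacuity)] -/
theorem covLettersY_nonempty : Nonempty (CovLettersY 𝔸 x) := ⟨covLettersY_flat 𝔸 x⟩

end Flat

end Literature.MathematicalPhysics.QuantumFieldTheory.Balaban1983to89.Node00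

end
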